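import Mathlib
import HarnessLib
import HarnessLib.Audit
import Summits.CriticalPhenomena.Statement
import Literature.Probability.LatticeModels.LocalIdentityMatrix
import Summits.CriticalPhenomena.Ising3DConformalLimit.Theorems.PerfectScreeningMoebiusLimitExistsTwoLeaf
import HarnessLib.Audit.Status.Attr

/-!
Route: DiracCensus

DORMANT since 2026-08-29T19:29:45Z (census g0: costume|duplicate of route-CriticalPhenomena-HyperoctahedralRP; reader census-reader-35-g0) — unstaffed, not closed; items shared with open routes are served there. `ledger route dormant <id> --off` reactivates.

# Route DiracCensus — exact 3D Dirac-type identity for decorated Ising currents ⇒ Möbius limit via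
Clifford analysis, with its arithmetic shadow tanh β_c(ℤ³) ∈ ℚ̄ as kill switch

It suffices to show X = (SI) ∧ (CT) ∧ (NG), realising card dirac-census-algebraic-betac (positive
branch of its census).
(SI) SPINOR IDENTITY: the n.n. Ising model on ℤ³ carries an exact, locally certified, finite-range
linear identity of
Dirac type for an SU(2)-holonomy-decorated random-current two-point observable F_t(a; z), with
coefficients in ℚ̄[t]
(t = tanh β), symbol elliptic on the torus for t < t_c and singular (massless) exactly at t_c —
filed informally at open
(its objects are definition requests), rank 2. (CT) CLIFFORD TRANSPLANT: given (SI), the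
Chelkak–Hongler–Izyurov
architecture run with discrete Clifford analysis on ℤ³ (discrete Borel–Pompeiu, convergence of
discrete monogenic
solutions, Möbius covariance of the Cauchy–Clifford kernel x̄/|x|³) delivers MoebiusLimitExists =
the conjunct minus
clause (iii) — layer 2, expanded only if (SI) closes. (NG) every non-degenerate limit is
non-Gaussian (shared item).
Typed now: the OUTPUT of (SI)+(CT) (MoebiusLimitExists), (NG), and the ARITHMETIC SHADOW of (SI) —
DichotomyLemma:
(SI) ⇒ tanh β_c(ℤ³) algebraic (TanhCriticalBetaAlgebraic, rank 3, the kill switch), resting on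
AlgebraicSpectralEdge
(Tarski–Seidenberg over the real algebraic numbers) and PolyMatrixKernelLocus (kernel locus of a
polynomial matrix).
Lean: `Summit.CriticalPhenomena.Ising3DConformalLimit.Theses.DiracCensus.TanhCriticalBetaAlgebraic ∧
Summit.CriticalPhenomena.Ising3DConformalLimit.Theses.DiracCensus.MoebiusLimitExists ∧
Summit.CriticalPhenomena.Ising3DConformalLimit.Theses.DiracCensus.NonGaussianAnyLimit` (the three
decls below; each elaborates in Sketch.lean, rc 0)

## Assembly
Pure logic (term proof `assembly_holds` in Sketch.lean): MoebiusLimitExists gives (ρ, Δ, S) with the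
limit, non-degeneracy and
Möbius covariance; NonGaussianAnyLimit applied to (ρ, S) gives HasNontrivialU4 S; together this is
the definiens of
Ising3DConformalLimit. TanhCriticalBetaAlgebraic is NOT an antecedent: it is the necessary condition
of the spine (SI) and is
carried in the Target, not in the implication. The spine (SI) and the transplant (CT) feed
MoebiusLimitExists at layer 2.

Rationale: WHY THIS LINE. Smirnov's planar engine is a LINEAR lattice identity (s-holomorphicity) for a
fermionic observable, certified by a local
pairing, massless exactly at t_c = √2−1 and massive off it (Smirnov2010, ChelkakSmirnov2012Ising,
ChelkakHonglerIzyurov2015);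
in 2D such identities exist precisely at Yang–Baxter-integrable algebraic weights, found as kernels
of small polynomial
matrices (RajabpourCardy2007; IkhlefCardy2009 §1, §3). The card reads the 3D question
ARITHMETICALLY: a finite-range
identity with ℚ̄[t] coefficients that is elliptic below and singular at t_c makes tanh β_c(ℤ³) a
boundary point of a
semialgebraic set defined over the real algebraic numbers, hence algebraic (BasuPollackRoy2006 Thm
2.77, Cor 2.79) —
an implication between two precise statements replacing the folklore "3D Ising is not
free-fermionic, β_c has no closed
form" (every proposed closed form has failed: Rosengren1986 vs Fisher1995, FerrenbergXuLandau2018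
§III.F; WuEtAl2008).
Imported areas: real algebraic geometry (quantifier elimination) for the shadow; discrete Clifford
analysis
(FaustinoKahlerSommen2007, GurlebeckHommel2001, GurlebeckHabethaSprossig2008 §6.2.2, Prop 7.7, Thms
7.8/7.12) as the
d = 3 stand-in for complex analysis, whose Möbius covariance is exactly the symmetry Liouville
leaves (clause (ii)).
Unlike the five open routes (upgrade / RP-rigidity / CFT-data / screening / anomalous-dimension
lines) this is the only
line that would CONSTRUCT the limit from a lattice equation; its expected failure mode is
informative and cheap to reach
(census + arithmetic), and its typed supports are closable now.

RANKED CRUXES. #0 Target (target) — X's typed shadow: tanh β_c(3) is algebraic ∧ a non-degenerate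
Möbius-covariant pointwise scaling limit of the critical correlators exists ∧ every non-degenerate
limit has U₄ ≢ 0. (why it might fail: (SI) is a bet against the non-integrability consensus for ℤ³
(ICM2022 §8.3–8.4); its shadow tanh β_c ∈ ℚ̄ has no surviving candidate; the 3D spin dictionary of
(CT) does not exist yet.) [DuminilCopinICM2022, IkhlefCardy2009, FerrenbergXuLandau2018,
ChelkakHonglerIzyurov2015]
#2 SpinorIdentityExists (crux; stmt-CriticalPhenomena-7158, filed informally at open, TYPED
2026-08-15 by the crux-attack refuter over the landed definitions decorationAlphabet /
decoratedClassSum, deliberately in DichotomyLemma's hypothesis shape) — the SPINE (SI): ∃ m k R A P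
β₀ — a finite stencil R ⊂ ℤ³, matrices A_u(t) ∈ M_m(ℚ̄[t]) and algebraic read-out matrices P_α on
the SU(2)-holonomy decoration classes — with (Alg) algebraic coefficients, (ND) the reduced
decorated field detects every v ≠ 0, β₀ < β_c(3), (L1) the identity Σ_(u∈R) (Σ_α decoratedClassSum ·
P_α)(a; z+u) · A_u(tanh β) = 0 away from the source for β ∈ (β₀, β_c], (E) symbol det ≠ 0 on 𝕋³ for
β ∈ (β₀, β_c), (S) det = 0 somewhere on 𝕋³ at β_c, and (NS) det ≢ 0 at β_c. (why it might fail: 2D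
analogues exist only at Yang–Baxter-integrable algebraic weights (IkhlefCardy2009 §3); ℤ³ Ising is
believed non-integrable (LoeblMasbaum2011 Thm 4; DuminilCopinICM2022 §8.3–8.4); (SI) forces tanh β_c
∈ ℚ̄, where every closed form has failed.) [IkhlefCardy2009, RajabpourCardy2007, LoeblMasbaum2011,
ReggeZecchina2000, Istrail2000, DuminilCopinICM2022, Smirnov2010, ChelkakSmirnov2012Ising,
FerrenbergXuLandau2018, FaustinoKahlerSommen2007]
#3 TanhCriticalBetaAlgebraic (crux) — tanh β_c(ℤ³) is an algebraic number — the necessary condition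
of (SI) (by DichotomyLemma: an exact finite-range ℚ̄[t]-linear structure elliptic below and massless
at β_c forces it); KILL SWITCH of the route: evidence against it is evidence against every locally
certified 3D discrete analyticity. [deps: DichotomyLemma] [difficulty: open-problem] (why it might
fail: No closed form for β_c(ℤ³) has survived: Rosengren's tanh β_c=(√5−2)cos(π/8) (β=0.2216586) is
4·10⁻⁶ ≈ 800σ off K_c=0.221654626(5) (FerrenbergXuLandau2018 §III.F; Fisher1995); non-integrability
consensus (DuminilCopinICM2022 §8.4) points to transcendence.) [Rosengren1986, Fisher1995,
FerrenbergXuLandau2018, WuEtAl2008, DuminilCopinICM2022]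
#4 MoebiusLimitExists (crux) — the critical Ising correlators on ℤ³ have a non-degenerate pointwise
scaling limit (ρ > 0 on (0,1], Δ > 0, S) that is Möbius covariant with dimension Δ — the conjunct
minus clause (iii); shared item stmt-CriticalPhenomena-1344, to be DELIVERED in this route by
(SI)+(CT) (layer 2). [difficulty: open-problem] (why it might fail: Here it must come from
(SI)+(CT): in d=3 a point spin cannot be the monodromy defect of a point fermion (codim-2 defects
are loops, the KW dual of σ is a Wilson loop), so CHI's multi-point dictionary has no known
analogue; Δ_σ≈0.5181 is not a free-field defect exponent.) [ChelkakHonglerIzyurov2015,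
DuminilCopinICM2022, KosPolandSimmonsDuffinVichi2016, GurlebeckHabethaSprossig2008]
#5 NonGaussianAnyLimit (crux) — every non-degenerate pointwise scaling limit of the renormalised
critical correlators on ℤ³ has connected four-point function U₄ ≢ 0 (shared item
stmt-CriticalPhenomena-0636); a linear (free-fermion-like) structure does NOT supply it — imported.
[difficulty: open-problem] (why it might fail: Open in d=3: needs the double-current intersection
probability to stay positive at macroscopic separation (Aizenman 1982; ADC2021 eq. (3.11)); for d ≥
4 every such limit IS Gaussian, and nothing d=3-specific is in hand.)
[AizenmanDuminilCopinAnnals2021, Aizenman1982,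
Literature.Barriers.CriticalPhenomena.IsingTrivialityFromDimensionFour]
#6 NoShortRangeSpinorIdentity (crux, informal — stmt-CriticalPhenomena-7186, no signature yet) — the
CENSUS, negative side of (SI) at small range: for every stencil R ⊆ B(0,2) ∩ ℤ³ and holonomy depth k
≤ 3 the local identity matrix M_(R,𝒜)(t) (definition LocalIdentityMatrix; per the route-repair memo
of 2026-08-15 the all-rows certificate is over-constrained and the census should be restated over
principal / IC-style rows before typing) has trivial kernel over ℚ̄(t) and at every t ∈ (0,1). (why
it might fail: a non-zero kernel vector at radius ≤ 2 would be a discovery exhibiting tanh β_c as an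
explicit algebraic number; the computation may be infeasible at radius 2 / depth 3, shrinking the
proved scope to radius 1.) [IkhlefCardy2009 §3, RajabpourCardy2007, FerrenbergXuLandau2018]
#9 AlgebraicSpectralEdge (support) — ALGEBRAIC SPECTRAL EDGE: for a trigonometric polynomial P(t,θ)
= Σ_k c_k t^(n_k) e^(i u_k·θ) on ℝ × ℝ^d with algebraic coefficients c_k, every boundary point of T
= {t ∈ ℝ | ∃ θ, P(t,θ) = 0} is algebraic (T is semialgebraic, defined over the real closed field of
real algebraic numbers: quantifier elimination with coefficients in that field, then Cor 2.79).
[difficulty: L] [BasuPollackRoy2006 Thm 2.77 and Cor 2.79, Tarski1951]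
#9 PolyMatrixKernelLocus (support) — KERNEL LOCUS: a polynomial matrix M(t) with algebraic
coefficients has a non-trivial kernel either at every t ∈ ℂ or only at algebraic t (some maximal
minor is a non-zero polynomial with algebraic coefficients) — the mechanism by which locally
certified lattice identities single out algebraic weights (IkhlefCardy2009 §3: a 5×5 determinant).
[difficulty: provable-now] [IkhlefCardy2009 §3, RajabpourCardy2007]
#9 DichotomyLemma (support) — THE DICHOTOMY LEMMA (card D1, corrected per the novelty audit:
ellipticity below β_c is a hypothesis): a finite-range translation-invariant matrix difference
operator on ℤ³ with coefficients in ℚ̄[tanh β], whose symbol is invertible on the torus for β ∈ (β₀,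
β_c(3)) and singular somewhere on the torus at β_c(3), forces tanh β_c(3) to be algebraic (det
reduces to AlgebraicSpectralEdge; tanh is a homeomorphism onto (−1,1)). [difficulty: L]
[BasuPollackRoy2006 Thm 2.77 and Cor 2.79, Smirnov2010, IkhlefCardy2009]
#9 CruxesGiveTarget (support, rev 5) — GLUE (route-choice repair 2026-08-16,
`route.target-unreachable`): TanhCriticalBetaAlgebraic → MoebiusLimitExists → NonGaussianAnyLimit →
Target. Pure logic (Target is by construction the conjunction of exactly the three typed cruxes;
`Iff.rfl` and the term `fun h₁ h₂ h₃ => ⟨h₁, h₂, h₃⟩` checked in the planner's Sketch.lean, rc 0):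
it makes X's typed shadow reachable from the cruxes in the item graph. The deciding theorem `closes`
deliberately keeps consuming only MoebiusLimitExists and NonGaussianAnyLimit (target minus the
kill-switch conjunct ⇒ Ising3DConformalLimit), so tanh β_c ∈ ℚ̄ stays diagnostic for the line and is
never load-bearing for the sub-problem. [deps: TanhCriticalBetaAlgebraic, MoebiusLimitExists,
NonGaussianAnyLimit] [difficulty: provable-now]
#10 SpineForcesAlgebraic (support, rev 6; rank 10 only so that the gate renders it below
DichotomyLemma) — GLUE, the route's dichotomy as a checked edge: SpinorIdentityExists →
DichotomyLemma → TanhCriticalBetaAlgebraic. Pure logic now that (SI) is typed in DichotomyLemma's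
hypothesis shape: from hSI obtain ⟨m, k, R, A, P, β₀, hAlg, _, _, hβ₀, _, hE, hS, _⟩ and apply hDL m
R A β₀ hAlg hβ₀ hE hS (checked in the planner's Sketch2.lean against the verbatim ledger signature,
rc 0, no sorry). Consequence for staffing: a refutation of TanhCriticalBetaAlgebraic together with a
proof of DichotomyLemma refutes the spine — the kill switch is wired, not narrated. [deps:
SpinorIdentityExists, DichotomyLemma, TanhCriticalBetaAlgebraic] [difficulty: provable-now]

TWO-LAYER PLAN. If (SI) closes positively (a certified identity with explicit algebraic t_c):
MoebiusLimitExists ⇐ CliffordBVPConvergence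
(discrete monogenic solutions of the identity's Riemann-type boundary value problems on δℤ³-domains
converge to continuum
monogenic functions; GurlebeckHommel2001, FaustinoKahlerSommen2007) → SpinDictionary (logarithmic
lattice derivatives of
the spin n-point functions are local functionals of multi-source solutions — the step with no known
3D analogue) →
MoebiusLimitExists (Möbius covariance of the Cauchy–Clifford kernel, GurlebeckHabethaSprossig2008
§6.2.2/§13). If the
census returns a kernel vector only AT t_c (integrable-point scenario), TanhCriticalBetaAlgebraic ⇐
PolyMatrixKernelLocus
directly. Nothing here is filed now.

KILL CRITERIA. (1) SpinorIdentityExists refuted, or TanhCriticalBetaAlgebraic marked suspect-false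
with evidence (every algebraic number
of small degree/height in the Monte-Carlo window excluded and no census hit) ⇒ close
`refuted:SpinorIdentityExists`; the
typed supports (AlgebraicSpectralEdge, PolyMatrixKernelLocus, DichotomyLemma) survive as the
arithmetic no-go "exact
finite-range linear structure at β_c ⇒ tanh β_c algebraic" for the barrier catalogue. (2)
NoShortRangeSpinorIdentity
proved (census negative at radius ≤ 2, depth ≤ 3) ⇒ not a refutation of (SI) at all ranges, but the
route goes dormant
with a barrier entry of recorded scope unless a longer-range mechanism is named. (3)
MoebiusLimitExists proved elsewhere ⇒
(SI)/(CT) moot, close superseded. (4) NonGaussianAnyLimit refuted ⇒ the conjunct itself is false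
(all routes close).

NOT DECOMPOSED YET. The transplant (CT) — discrete Borel–Pompeiu on ℤ³ domains, convergence of
discrete monogenic functions, identification
of the limit kernel, and above all the multi-point SPIN DICTIONARY (in 2D: monodromy −1 around spins
on a double cover;
in 3D points carry no monodromy, so the dictionary must come from the SU(2)-holonomy classes
themselves) — is layer 2
after (SI). The first-order (Clifford) degeneration of the symbol at its torus zero, needed for a
|x|⁻² Cauchy–Clifford
kernel rather than a |x|⁻¹ Laplacian one, is part of (SI)'s informal text, not a separate item.
Constants of the census
(radius 2, depth 3) are the card's; widening them is a resplit, not a new item.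

CHEAPEST FALSIFIER. Run the census pipeline's built-in control FIRST: on ℤ² with the winding (U(1))
decoration it must return a non-zero
kernel reproducing Smirnov's s-holomorphicity relation and, through DichotomyLemma, t_c = √2−1 as
the root of t²+2t−1;
then ℤ³ at radius 1, depth 1 (hours of exact rational arithmetic, kit job). A pipeline that passes
the 2D control and
finds ker M = 0 on ℤ³ at radius 1 already retires the cheapest version of (SI). Arithmetic side: a
PSLQ scan of
tanh K_c = 0.2180945523(48) against integer polynomials of degree ≤ 6 is cheap but only weakly
informative (the MC window
±5·10⁻⁹ contains algebraic numbers of modest height); it can exclude NAMED candidates (Rosengren's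
is out by 800σ), not
algebraicity. Not run here (hub is compute-free; no kit job was needed to file the route).

NUMBERS. K_c(ℤ³) = 0.221654626(5) (FerrenbergXuLandau2018, abstract and §III.B–C); tanh K_c =
0.2180945523(48); Rosengren1986:
tanh K_c = (√5−2)cos(π/8) = 0.2180983727…, K = 0.2216586…, off by 4.0·10⁻⁶ ≈ 800σ
(FerrenbergXuLandau2018 §III.F: "Neither
the Rosengren's 'exact conjecture' nor Zhang's so-called 'exact' solution agree with our numerical
values"; WuEtAl2008).
2D control: t_c = √2−1, root of t²+2t−1. Exponents: Δ_σ(3D) = 0.5181489(10)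
(KosPolandSimmonsDuffinVichi2016) vs the
rigorous window 1/2 ≤ Δ ≤ 1 (Literature.Probability.LatticeModels.scalingDimension_mem_Icc, proved)
and the decay |x|⁻²
(Δ = 1, free Dirac) of a first-order massless lattice Green kernel in d = 3. Items at open: 8 typed
(1 target, 3 cruxes,
3 supports, 1 assembly) + 2 informal cruxes filed after open = 10; SpinorIdentityExists typed
2026-08-15 (refuter
set-signature); route-choice repair 2026-08-16 adds the glue supports CruxesGiveTarget (rev 5) and
SpineForcesAlgebraic
(rev 6) = 12 items (5 cruxes of which 1 still informal, 5 supports, 1 target, 1 assembly).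

DEFINITION REQUESTS. Filed right after open (kind definition, topic
Summits/CriticalPhenomena/Ising3DConformalLimit/Theorems, for SpinorIdentityExists):
(D1) DecoratedCurrentObservable — for a finite subgraph Λ of ℤ³, t ∈ ℝ, source a, probe z: F_t(a; z)
=
Σ_(n : Current Λ, sources n = {a,z}) t^|n| · Hol(γ(n)) / Σ_(sources n = ∅) t^|n|, where γ(n) is the
CANONICALLY RESOLVED
backbone from a to z (fixed deterministic local splitting rule at vertices of odd degree > 1, part
of the definition) and
Hol(γ) ∈ SU(2) is the product over consecutive turns of γ of the spin-½ lift of the minimal rotation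
between successive
directions (values in the binary octahedral group 2O); extends
Literature.Probability.LatticeModels.Current / currentSum.
(D2) LocalIdentityMatrix — for a stencil R ⊂ ℤ³ and decoration alphabet 𝒜 (arrival direction ×
holonomy class of depth
≤ k): the matrix M_(R,𝒜)(t) over ℤ[2O-entries][t] whose rows are boundary patterns of currents
entering R and whose columns
are pairs (u, a) ∈ R × 𝒜, such that Σ c_(u,a)(t) F^a_t(z+u) ≡ 0 on every graph locally isomorphic to
ℤ³ iff c(t) ∈ ker M(t).
Cite facts wanted: none beyond references.bib keys added this session (Rosengren1986, Fisher1995,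
FerrenbergXuLandau2018,
RajabpourCardy2007, FaustinoKahlerSommen2007, WuEtAl2008, GurlebeckHommel2001).

Novelty: Searches (2026-08-15): `lit search --source crossref` ×9 ("Rosengren Ising simple cubic 1986" →
Rosengren1986 via
HaggkvistEtAl 2007 Adv. Phys. doi:10.1080/00018730701577548; "Fisher critical polynomial simple
cubic Ising" → Fisher1995
doi:10.1088/0305-4470/28/22/009; "Wu McCoy Fisher Chayes comment conjectured solution" → WuEtAl2008
+ Perk 2023
doi:10.3390/sym15020374; "Rajabpour Cardy discretely holomorphic parafermions" → 5 hits incl. Ikhlef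
2012
doi:10.1088/1751-8113/45/26/265001; "Faustino Kähler Sommen discrete Dirac" →
FaustinoKahlerSommen2007, KählerSommen 2015
doi:10.1007/978-3-0348-0667-1_18; "discrete fundamental solution Dirac lattice Gürlebeck Hommel" →
GurlebeckHommel2001,
Legatiuk–Gürlebeck–Hommel 2018 doi:10.1007/s00006-018-0887-2; "Möbius covariance monogenic Clifford
Ryan" → Juhl 2009 only;
"Kos Poland Simmons-Duffin Vichi precision islands" → doi:10.1007/jhep08(2016)036); `lit frontier
CriticalPhenomena --since
2021` (30 rows, none on 3D lattice fermions / discrete Dirac structures); `lit bridges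
CriticalPhenomena --cross any` (30
rows, none relevant); `lit search --source zbmath` ×2 (0 hits); `lit galaxy search "critical point
of the three-dimensional
Ising model algebraic" --star all` and `"discrete Dirac operator Ising" --star all` (galaxyd
saturated, 0 rows returned —
the card's audit of 2026-08-15 ran galaxy-intelligent + vsearch + crossref and found nothing); held
texts read:
FerrenbergXuLandau2018 (arXiv:1806.03558 §I, §VII), IkhlefCardy2009 (arXiv:0  [refs: 10.1080/00018730701577548, 10.1088/0305-4470/28/22/009, 10.3390/sym15020374, 10.1088/1751-8113/45/26/265001, 10.1007/978-3-0348-0667-1_18, 10.1007/s00006-018-0887-2, 10.1007/jhep08(2016, 10.1103/physrevlett.76.344, 1806.03558, 0810.5037, doi:10.1080/00018730701577548, doi:10.1088/0305-4470/28/22/009, doi:10.3390/sym15020374, doi:10.1088/1751-8113/45/26/265001, doi:10.1007/978-3-0348-0667-1_18, doi]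

Barriers (technique_class: discrete-dirac, clifford-analysis, identity-search): - technique_class: discrete-dirac, clifford-analysis, identity-search
- Literature.Barriers.CriticalPhenomena.LiouvilleRigidity: not in its class after the 2026-08-15
narrowing (the theorem constrains conformal MAPS, not discrete function theory); the line uses only
what survives in d = 3 — Möbius covariance of monogenic kernels = clause (ii)
(LiouvilleRigidityNarrow) — and meets the obstruction the audit names instead
(non-planarity/integrability: LoeblMasbaum2011 Thm 4, ReggeZecchina2000, Istrail2000) head-on: (SI)
IS that bet, and the census + DichotomyLemma are its falsifiers.
- Literature.Barriers.CriticalPhenomena.ScaleCovarianceNotMoebius: not engaged — no Euclidean/scale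
⇒ Möbius upgrade is used; covariance would come from an explicit Möbius-covariant limit kernel.
- Literature.Barriers.CriticalPhenomena.BootstrapLatticeBlindness: not engaged — every step is a
statement about criticalCorr 3 / lattice currents, nothing lattice-blind.
- Literature.Barriers.CriticalPhenomena.IsingTrivialityFromDimensionFour: it does not evade it for
clause (iii); the bet is that U₄ ≢ 0 is imported (NonGaussianAnyLimit, shared 0636) — a linear
structure cannot supply non-Gaussianity; the census itself is d = 3-specific (SU(2) holonomy, ℤ³
stencils), not dimension-uniform.
- Literature.Barriers.CriticalPhenomena.ParafermionicHalfCauchyRiemann: catalogued for the planar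
conjuncts, but its lesson ("half of Cauchy–Riemann": vertex relations that do not DETERMINE the
observable) is why (SI) de

History (route lifecycle, newest last):
- 2026-08-15T11:48:03Z · rev 1: restated Target (stmt-CriticalPhenomena-5408) — restate Target with the three conjuncts inlined (the gate renders the target before the crux decls, so the short names were forward references); meaning unchang (planner-plancard-CriticalPhenomena-Ising3DCon-f556aaa0-0)
- 2026-08-25T04:31:49Z · DORMANT — reconciler: no traction for 7.4 d (last activity item-evidence-added at 2026-08-17T19:00:39Z); parked, not closed — `ledger route dormant route-CriticalPhenomen (operator:999:2687709)
- 2026-08-27T13:09:56Z · REACTIVATED — reconciler: reactivated — activity statement-claimed at 2026-08-27T11:07:20Z after parking at 2026-08-25T04:31:49Z (operator:999:105563)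
- 2026-08-29T19:29:45Z · DORMANT — census g0: costume|duplicate of route-CriticalPhenomena-HyperoctahedralRP; reader census-reader-35-g0 (operator:999:1053748)

sub-problem: Ising3DConformalLimit · status: dormant · opened planner-plancard-CriticalPhenomena-Ising3DCon-f556aaa0-0 2026-08-15T11:41:04Z · rev 8 · ledger route-CriticalPhenomena-DiracCensus
GENERATED by the gate from the ledger (D-0016/17). Provers cite these decls: `theorem foo : Summit.CriticalPhenomena.Ising3DConformalLimit.Theses.DiracCensus.<Decl> := …` in Summits/CriticalPhenomena/Ising3DConformalLimit/Theorems/<Name>.lean.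
-/

namespace Summit.CriticalPhenomena.Ising3DConformalLimit.Theses.DiracCensus

open scoped BigOperators Topology Manifold Classical MeasureTheory ProbabilityTheory Matrix InnerProductSpace ComplexConjugate ContinuousMap
open Filter Set Function TopologicalSpace MeasureTheory

attribute [summit_statement] _root_.Ising3DConformalLimit

-- earlier Target (stmt-CriticalPhenomena-5408, replaced 2026-08-15T11:48:03Z -> stmt-CriticalPhenomena-6553): retired by None — TanhCriticalBetaAlgebraic ∧ MoebiusLimitExists ∧ NonGaussianAnyLimit
/-- item stmt-CriticalPhenomena-6553 · target · rank 0 · open · by planner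
why it might fail: (SI) is a bet against the non-integrability consensus for ℤ³ (ICM2022 §8.3–8.4); its shadow tanh β_c ∈ ℚ̄ has no surviving candidate; the 3D spin dictionary of (CT) does not exist yet.
sources: DuminilCopinICM2022, IkhlefCardy2009, FerrenbergXuLandau2018, ChelkakHonglerIzyurov2015
[target] X's typed shadow: tanh β_c(3) is algebraic ∧ a non-degenerate Möbius-covariant pointwise
scaling limit of the critical correlators exists ∧ every non-degenerate limit has U₄ ≢ 0. -/
@[route_item "route-CriticalPhenomena-DiracCensus"]
def Target : Prop :=
  (IsAlgebraic ℚ (Real.tanh (Literature.Probability.LatticeModels.criticalBeta 3))) ∧ (∃ (ρ : ℝ → ℝ) (Δ : ℝ) (S : Literature.Probability.LatticeModels.CorrFamily 3), (∀ δ ∈ Set.Ioc (0:ℝ) 1, 0 < ρ δ) ∧ 0 < Δ ∧ Literature.Probability.LatticeModels.HasPointwiseScalingLimit (Literature.Probability.LatticeModels.criticalCorr 3) ρ S ∧ Literature.Probability.LatticeModels.IsNondegenerateTwoPoint S ∧ Literature.Probability.LatticeModels.IsMoebiusCovariant Δ S) ∧ (∀ (ρ : ℝ → ℝ) (S : Literature.Probability.LatticeModels.CorrFamily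 3), (∀ δ ∈ Set.Ioc (0:ℝ) 1, 0 < ρ δ) → Literature.Probability.LatticeModels.HasPointwiseScalingLimit (Literature.Probability.LatticeModels.criticalCorr 3) ρ S → Literature.Probability.LatticeModels.IsNondegenerateTwoPoint S → Literature.Probability.LatticeModels.HasNontrivialU4 S)

/-- item stmt-CriticalPhenomena-7158 · crux · rank 2 · open · by planner
why it might fail: 2D analogues exist only at Yang-Baxter-integrable algebraic weights (IkhlefCardy2009 §3); Z^3 Ising is believed non-integrable (LoeblMasbaum2011 Thm 4; DuminilCopinICM2022 §8.4); (SI) forces tanh(beta_c) algebraic, yet no closed form survived (FerrenbergXuLandau2018).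
sources: IkhlefCardy2009, RajabpourCardy2007, LoeblMasbaum2011, ReggeZecchina2000, Istrail2000, DuminilCopinICM2022
[crux] SPINOR IDENTITY EXISTS — the spine (card dirac-census-algebraic-betac, positive branch of its
census). There exist a finite stencil R ⊂ ℤ³, a finite decoration alphabet 𝒜 (arrival direction ×
SU(2) spin-holonomy class, depth ≤ k, of the canonically resolved backbone; values in a Clifford
module ℂ^m) and coefficient matrices c_{u,a}(t) ∈ M_m(ℚ̄[t]), t = tanh β, such that the decorated
random-current two-point observable F_t(a; z) = Σ_{∂n={a,z}} t^{|n|} Hol(γ(n)) / Σ_{∂n=∅} t^{|n|} of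
the n.n. Ising model on ℤ³ (definition request DecoratedCurrentObservable) satisfies Σ_{(u,a)∈R×𝒜}
c_{u,a}(t) F^a_t(z+u) = 0 for all z ∉ a+R and all t in an interval (t₀, t_c], the identity being
LOCALLY CERTIFIED (c(t) ∈ ker M_{R,𝒜}(t), definition request LocalIdentityMatrix), with symbol Σ_u
e^{iu·θ} c_u(t) ELLIPTIC (invertible on 𝕋³) for t ∈ (t₀, t_c) and SINGULAR somewhere on 𝕋³ at t_c
with a first-order (Clifford/Dirac-type) degeneration — massive below, massless exactly at
criticality, as Smirnov's fermion in 2D. Consequences already typed in this route: DichotomyLemma ⇒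
TanhCriticalBetaAlgebraic; with the transplant (layer 2) ⇒ MoebiusLimitExists. WHY IT MIGHT FAIL: in
2D lattice holomorph -/
@[route_item "route-CriticalPhenomena-DiracCensus"]
def SpinorIdentityExists : Prop :=
  ∃ (m k : ℕ) (R : Finset (Fin 3 → ℤ)) (A : (Fin 3 → ℤ) → Matrix (Fin m) (Fin m) (Polynomial ℂ)) (P : ↥(Literature.Probability.LatticeModels.decorationAlphabet k) → Matrix (Fin 2) (Fin m) ℂ) (β₀ : ℝ), (∀ u i j n, IsAlgebraic ℚ ((A u i j).coeff n)) ∧ (∀ α i r, IsAlgebraic ℚ (P α i r)) ∧ (∀ v : Fin m → ℂ, v ≠ 0 → ∃ β ∈ Set.Ioc β₀ (Literature.Probability.LatticeModels.criticalBeta 3), ∃ (Λ : Finset (Fin 3 → ℤ)) (z : ↥Λ) (a : ↥Λ), (∑ α : ↥(Literature.Probability.LatticeModels.decorationAlphabet k), Literature.Probability.LatticeModels.decoratedClassSum (SimpleGraph.comap (Subtype.val : ↥Λ → Fin 3 → ℤ) (Literature.Probability.LatticeModels.zdGraph 3)) Subtype.val (Real.tanh β) a z k α.1 * P α).mulVec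 v ≠ 0) ∧ β₀ < Literature.Probability.LatticeModels.criticalBeta 3 ∧ (∀ β ∈ Set.Ioc β₀ (Literature.Probability.LatticeModels.criticalBeta 3), ∀ (Λ : Finset (Fin 3 → ℤ)) (z : Fin 3 → ℤ) (hz : ∀ u ∈ R, z + u ∈ Λ) (a : ↥Λ), (∀ u ∈ R, (a : Fin 3 → ℤ) ≠ z + u) → ∑ u ∈ R.attach, (∑ α : ↥(Literature.Probability.LatticeModels.decorationAlphabet k), Literature.Probability.LatticeModels.decoratedClassSum (SimpleGraph.comap (Subtype.val : ↥Λ → Fin 3 → ℤ) (Literature.Probability.LatticeModels.zdGraph 3)) Subtype.val (Real.tanh β) a ⟨z + u.1, hz u.1 u.2⟩ k α.1 * P α) * (A u.1).map (fun p => p.eval ((Real.tanh β : ℝ) : ℂ)) = 0) ∧ (∀ β ∈ Set.Ioo β₀ (Literature.Probability.LatticeModels.criticalBeta 3), ∀ θ : Fin 3 → ℝ, (∑ u ∈ R, Complex.exp (Complex.I * ∑ j : Fin 3, ((u j : ℤ) : ℂ) * ((θ j : ℝ) : ℂ)) • (A u).map (fun p => p.eval ((Real.tanh β : ℝ) : ℂ))).det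 ≠ 0) ∧ (∃ θ : Fin 3 → ℝ, (∑ u ∈ R, Complex.exp (Complex.I * ∑ j : Fin 3, ((u j : ℤ) : ℂ) * ((θ j : ℝ) : ℂ)) • (A u).map (fun p => p.eval ((Real.tanh (Literature.Probability.LatticeModels.criticalBeta 3) : ℝ) : ℂ))).det = 0) ∧ (∃ θ : Fin 3 → ℝ, (∑ u ∈ R, Complex.exp (Complex.I * ∑ j : Fin 3, ((u j : ℤ) : ℂ) * ((θ j : ℝ) : ℂ)) • (A u).map (fun p => p.eval ((Real.tanh (Literature.Probability.LatticeModels.criticalBeta 3) : ℝ) : ℂ))).det ≠ 0)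

/-- item stmt-CriticalPhenomena-5409 · crux · rank 3 · open · by planner
why it might fail: No closed form for β_c(ℤ³) has survived: Rosengren's tanh β_c=(√5−2)cos(π/8) (β=0.2216586) is 4·10⁻⁶ ≈ 800σ off K_c=0.221654626(5) (FerrenbergXuLandau2018 §III.F; Fisher1995); non-integrability consensus (DuminilCopinICM2022 §8.4) points to transcendence.
sources: Rosengren1986, Fisher1995, FerrenbergXuLandau2018, WuEtAl2008, DuminilCopinICM2022
[crux] tanh β_c(ℤ³) is an algebraic number — the necessary condition of (SI) (by DichotomyLemma: an
exact finite-range ℚ̄[t]-linear structure elliptic below and massless at β_c forces it); KILL SWITCH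
of the route: evidence against it is evidence against every locally certified 3D discrete
analyticity. [deps: DichotomyLemma] [difficulty: open-problem] -/
@[route_item "route-CriticalPhenomena-DiracCensus"]
def TanhCriticalBetaAlgebraic : Prop :=
  IsAlgebraic ℚ (Real.tanh (Literature.Probability.LatticeModels.criticalBeta 3))

/-- item stmt-CriticalPhenomena-1344 · crux · rank 4 · SPLIT (gen 1) into ExistsScaleCovariantLimit, InversionUpgradeNormalised + glue Summit.CriticalPhenomena.Ising3DConformalLimit.MoebiusLimitExistsTwoLeaf.MoebiusLimitExists_of_leaves · direct attempts still welcome (low priority) · by planner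
why it might fail: Here it must come from (SI)+(CT): in d=3 a point spin cannot be the monodromy defect of a point fermion (codim-2 defects are loops, the KW dual of σ is a Wilson loop), so CHI's multi-point dictionary has no known analogue; Δ_σ≈0.5181 is not a free-field defect exponent.
sources: ChelkakHonglerIzyurov2015, DuminilCopinICM2022, KosPolandSimmonsDuffinVichi2016, GurlebeckHabethaSprossig2008
[crux] r5 = MoebLim (IMPORTED COMPLEMENT, lowest rank): the critical Ising correlators on ℤ³ have a
non-degenerate pointwise scaling limit (ρ > 0 on (0,1], Δ > 0, S) that is Möbius covariant with
dimension Δ — the conjunct Ising3DConformalLimit minus clause (iii). Written verbatim as the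
conjunct's definiens without '∧ HasNontrivialU4 S' so that other routes filing the same complement
attach here. This route does not attack existence, rotation or inversion covariance; it bets on the
covariance lines (IsingEuclidUpgrade r5/r6 = items 0637/0638, IsingCFTData r2 = 0665, cards
hyperoctahedral-rp-rigidity / inversion-first-moebius-from-translations). S may be taken 0 off
NonCoincident, so no coincident-configuration junk obstructs the existential. -/
@[route_item "route-CriticalPhenomena-DiracCensus", crux]
def MoebiusLimitExists : Prop :=
  ∃ (ρ : ℝ → ℝ) (Δ : ℝ) (S : Literature.Probability.LatticeModels.CorrFamily 3), (∀ δ ∈ Set.Ioc (0:ℝ) 1, 0 < ρ δ) ∧ 0 < Δ ∧ Literature.Probability.LatticeModels.HasPointwiseScalingLimit (Literature.Probability.LatticeModels.criticalCorr 3) ρ S ∧ Literature.Probability.LatticeModels.IsNondegenerateTwoPoint S ∧ Literature.Probability.LatticeModels.IsMoebiusCovariant Δ S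

-- parent: MoebiusLimitExists · child (gen 1)
/--     item stmt-CriticalPhenomena-1981 · crux · rank 401 · open
    parent: MoebiusLimitExists · by planner
    why it might fail: Existence of the full δ→0⁺ limit of all n-point functions with one continuous Δ > 0 is the open problem on ℤ³ (ICM2022 §8.4 p.29, 'widely open'): c|x|⁻² ≤ G ≤ C|x|⁻¹ (ADS2015, DC–Panis) gives only subsequential limits, Δ ∈ [1/2,1]; no uniqueness / exact scale-covariance mechanism known in d = 3.
    sources: DuminilCopinICM2022, DuminilcopinPanis2025, AizenmanDuminilCopinSidoravicius2015, AizenmanDuminilCopinAnnals2021, Literature.Probability.LatticeModels.PointwiseScalingLimitDiscreteScaleInvariance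
[crux r4, (C), existence WITHOUT rotations] There are ρ > 0 on (0,1], Δ > 0 and S with
HasPointwiseScalingLimit (criticalCorr 3) ρ S, S = 0 off NonCoincident, IsNondegenerateTwoPoint S,
IsTranslationInvariant S, IsScaleCovariant Δ S. Strictly weaker than CritIsing3DEuclideanLimit (item
0638: rotations included) — on this route isotropy is OUTPUT. Inputs in tree:
criticalTwoPoint_bounds_holds (c|x|⁻² ≤ G ≤ C|x|⁻¹ ⇒ subsequential limits, Δ ∈ [1/2,1]); missing:
uniqueness/full-filter convergence and continuous scale covariance (DuminilCopinICM2022 §8.4 p.29: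
'widely open'). -/
@[route_item "route-CriticalPhenomena-DiracCensus", crux]
def ExistsScaleCovariantLimit : Prop :=
  ∃ (ρ : ℝ → ℝ) (Δ : ℝ) (S : Literature.Probability.LatticeModels.CorrFamily 3), (∀ δ ∈ Set.Ioc (0:ℝ) 1, 0 < ρ δ) ∧ 0 < Δ ∧ Literature.Probability.LatticeModels.HasPointwiseScalingLimit (Literature.Probability.LatticeModels.criticalCorr 3) ρ S ∧ (∀ n z, z ∉ Literature.Probability.LatticeModels.NonCoincident 3 n → S n z = 0) ∧ Literature.Probability.LatticeModels.IsNondegenerateTwoPoint S ∧ Literature.Probability.LatticeModels.IsTranslationInvariant S ∧ Literature.Probability.LatticeModels.IsScaleCovariant Δ S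

-- parent: MoebiusLimitExists · child (gen 1)
/--     item stmt-CriticalPhenomena-1982 · crux · rank 402 · open
    parent: MoebiusLimitExists · by planner
    why it might fail: Scale + Euclid (+ RP) ⇏ inversion covariance in general (free Maxwell d = 3, ElshowkNakayamaRychkov2011; witnessFamily of ScaleCovarianceNotMoebius); for Ising it rests on absence of a Δ = 2 virial current, backed only by non-rigorous RG (DTW2016 §5–6) and Monte-Carlo Δ_V > 5 (MenesesEtAl2019).
    sources: ElshowkNakayamaRychkov2011, Nakayama2015, DelamotteTissierWschebor2016, MenesesEtAl2019, PolandRychkovVichi2019, Literature.Barriers.CriticalPhenomena.ScaleCovarianceNotMoebius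
[crux r5, (D), inversion upgrade re-typed] Every pointwise scaling limit S of criticalCorr 3 (ρ > 0
on (0,1]) that is normalised (S = 0 off NonCoincident), non-degenerate, Euclidean invariant and
scale covariant with Δ is IsInversionCovariant Δ (hence Möbius). This is (U) of route
IsingEuclidUpgrade (item 0637, refuted AS TYPED by not_inversionUpgrade_of_euclideanLimit through
values on the coincident locus) with the normalisation hypothesis the refutation file prescribes;
the model-blind version is false (Literature.Barriers.CriticalPhenomena.ScaleCovarianceNotMoebius;
free Maxwell d=3, ElshowkNakayamaRychkov2011), so any proof must use the Ising hypothesis (RP +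
locality / absence of a dimension-2 virial current: DelamotteTissierWschebor2016 §5–6,
Nakayama2015). -/
@[route_item "route-CriticalPhenomena-DiracCensus", crux]
def InversionUpgradeNormalised : Prop :=
  ∀ (ρ : ℝ → ℝ) (Δ : ℝ) (S : Literature.Probability.LatticeModels.CorrFamily 3), (∀ δ ∈ Set.Ioc (0:ℝ) 1, 0 < ρ δ) → Literature.Probability.LatticeModels.HasPointwiseScalingLimit (Literature.Probability.LatticeModels.criticalCorr 3) ρ S → (∀ n z, z ∉ Literature.Probability.LatticeModels.NonCoincident 3 n → S n z = 0) → Literature.Probability.LatticeModels.IsNondegenerateTwoPoint S → Literature.Probability.LatticeModels.IsEuclideanInvariant S → Literature.Probability.LatticeModels.IsScaleCovariant Δ S → Literature.Probability.LatticeModels.IsInversionCovariant Δ S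

/-- glue for the split of `MoebiusLimitExists`: landed theorem `Summit.CriticalPhenomena.Ising3DConformalLimit.MoebiusLimitExistsTwoLeaf.MoebiusLimitExists_of_leaves`. -/
theorem MoebiusLimitExistsGlueBy_holds : ExistsScaleCovariantLimit → InversionUpgradeNormalised → MoebiusLimitExists := _root_.Summit.CriticalPhenomena.Ising3DConformalLimit.MoebiusLimitExistsTwoLeaf.MoebiusLimitExists_of_leaves

/-- item stmt-CriticalPhenomena-0636 · crux · rank 5 · open · by planner
why it might fail: Open in d=3: needs the double-current intersection probability to stay positive at macroscopic separation (Aizenman 1982; ADC2021 eq. (3.11)); for d ≥ 4 every such limit IS Gaussian, and nothing d=3-specific is in hand.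
sources: AizenmanDuminilCopinAnnals2021, Aizenman1982, Literature.Barriers.CriticalPhenomena.IsingTrivialityFromDimensionFour
Crux r4 (non-triviality in d=3): every non-degenerate pointwise scaling limit S of the renormalised
critical Ising correlators on Z^3 has connected four-point function U4 ≢ 0 on non-coincident
configurations. Intended tool: the random-current identity U4(x,y,z,t) =
−2⟨σxσy⟩⟨σzσt⟩·P^{xy,zt}[C_{n1+n2}(x) ∩ C_{n1+n2}(z) ≠ ∅] (Aizenman 1982; ADC2021 arXiv:1912.07973
eq. (3.11)): non-Gaussianity ⇔ the intersection probability of the two double-current clusters at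
macroscopic separation does not vanish as δ → 0. Contrast: for d ≥ 4 every such limit IS Gaussian
(Literature.Probability.LatticeModels.highDim_triviality). Its negation refutes the conjunct
Ising3DConformalLimit itself. -/
@[route_item "route-CriticalPhenomena-DiracCensus", crux]
def NonGaussianAnyLimit : Prop :=
  ∀ (ρ : ℝ → ℝ) (S : Literature.Probability.LatticeModels.CorrFamily 3), (∀ δ ∈ Set.Ioc (0:ℝ) 1, 0 < ρ δ) → Literature.Probability.LatticeModels.HasPointwiseScalingLimit (Literature.Probability.LatticeModels.criticalCorr 3) ρ S → Literature.Probability.LatticeModels.IsNondegenerateTwoPoint S → Literature.Probability.LatticeModels.HasNontrivialU4 S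

-- item stmt-CriticalPhenomena-7186 · crux · rank 6 · open · by planner — informal only, no Lean statement yet:
--   [crux] NO SHORT-RANGE SPINOR IDENTITY — negative side of SpinorIdentityExists at small range = the
--   card's CENSUS (declared inelegant-but-decisive). For every stencil R ⊆ B(0,2) ∩ ℤ³ and every
--   holonomy depth k ≤ 3, the local identity matrix M_{R,𝒜}(t) (definition request LocalIdentityMatrix:
--   rows = boundary patterns of currents entering R with their holonomy classes, columns = (u,a) ∈ R ×
--   𝒜, entries in ℤ[ζ][t], ζ from the binary octahedral group 2O ⊂ SU(2)) has TRIVIAL kernel over ℚ̄(t)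
--   and at every t ∈ (0,1) — equivalently (PolyMatrixKernelLocus) some maximal minor is a non-zero
--   polynomial wit

/-- item stmt-CriticalPhenomena-14149 · support · rank 9 · open · by planner
sources: Summits/CriticalPhenomena/Ising3DConformalLimit/Ideas/dirac-census-algebraic-betac.md, DuminilCopinICM2022
[support] GLUE (route-choice repair 2026-08-16, `route.target-unreachable`): the three typed cruxes
give the typed target — TanhCriticalBetaAlgebraic (r3, the kill switch; fed informally by
SpinorIdentityExists through DichotomyLemma) → MoebiusLimitExists (r4; fed at layer 2 by (SI)+(CT))
→ NonGaussianAnyLimit (r5, imported) → Target. Pure logic: Target (stmt-6553) is by construction the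
conjunction of exactly these three decls, inlined at rev 1 only because the gate renders the target
above the crux decls (`Target ↔ TanhCriticalBetaAlgebraic ∧ MoebiusLimitExists ∧
NonGaussianAnyLimit` is `Iff.rfl`, and the glue is `fun h₁ h₂ h₃ => ⟨h₁, h₂, h₃⟩`, both checked in
the planner's Sketch.lean, rc 0). It records in the item graph what the thesis says in words (cruxes
⇒ X's typed shadow); the deciding theorem `closes` keeps consuming only MoebiusLimitExists and
NonGaussianAnyLimit (the target minus the kill-switch conjunct ⇒ Ising3DConformalLimit), so the
arithmetic conjunct stays diagnostic, not load-bearing for the sub-problem. [deps: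
TanhCriticalBetaAlgebraic, MoebiusLimitExists, NonGaussianAnyLimit, Target] [difficulty:
provable-now] -/
@[route_item "route-CriticalPhenomena-DiracCensus"]
def CruxesGiveTarget : Prop :=
  TanhCriticalBetaAlgebraic → MoebiusLimitExists → NonGaussianAnyLimit → Target

/-- item stmt-CriticalPhenomena-5410 · support · rank 9 · open · by planner
sources: BasuPollackRoy2006 Thm 2.77 and Cor 2.79, Tarski1951
[support] ALGEBRAIC SPECTRAL EDGE: for a trigonometric polynomial P(t,θ) = Σ_k c_k t^(n_k) e^(i
u_k·θ) on ℝ × ℝ^d with algebraic coefficients c_k, every boundary point of T = {t ∈ ℝ | ∃ θ, P(t,θ)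
= 0} is algebraic (T is semialgebraic, defined over the real closed field of real algebraic numbers:
quantifier elimination with coefficients in that field, then Cor 2.79). [difficulty: L] -/
@[route_item "route-CriticalPhenomena-DiracCensus"]
def AlgebraicSpectralEdge : Prop :=
  ∀ (d : ℕ) (s : Finset (ℕ × (Fin d → ℤ))) (c : ℕ × (Fin d → ℤ) → ℂ), (∀ k ∈ s, IsAlgebraic ℚ (c k)) → ∀ t₀ ∈ frontier {t : ℝ | ∃ θ : Fin d → ℝ, (∑ k ∈ s, c k * (t : ℂ) ^ k.1 * Complex.exp (Complex.I * ∑ j : Fin d, ((k.2 j : ℤ) : ℂ) * ((θ j : ℝ) : ℂ))) = 0}, IsAlgebraic ℚ t₀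

/-- item stmt-CriticalPhenomena-5411 · support · rank 9 · open · by planner
sources: IkhlefCardy2009 §3, RajabpourCardy2007
[support] KERNEL LOCUS: a polynomial matrix M(t) with algebraic coefficients has a non-trivial
kernel either at every t ∈ ℂ or only at algebraic t (some maximal minor is a non-zero polynomial
with algebraic coefficients) — the mechanism by which locally certified lattice identities single
out algebraic weights (IkhlefCardy2009 §3: a 5×5 determinant). [difficulty: provable-now] -/
@[route_item "route-CriticalPhenomena-DiracCensus"]
def PolyMatrixKernelLocus : Prop :=
  ∀ (r s : ℕ) (M : Matrix (Fin r) (Fin s) (Polynomial ℂ)), (∀ i j n, IsAlgebraic ℚ ((M i j).coeff n)) → (∀ t : ℂ, ∃ v : Fin s → ℂ, v ≠ 0 ∧ (M.map (fun p => p.eval t)).mulVec v = 0) ∨ (∀ t : ℂ, (∃ v : Fin s → ℂ, v ≠ 0 ∧ (M.map (fun p => p.eval t)).mulVec v = 0) → IsAlgebraic ℚ t)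

/-- item stmt-CriticalPhenomena-5412 · support · rank 9 · open · by planner
sources: BasuPollackRoy2006 Thm 2.77 and Cor 2.79, Smirnov2010, IkhlefCardy2009
[support] THE DICHOTOMY LEMMA (card D1, corrected per the novelty audit: ellipticity below β_c is a
hypothesis): a finite-range translation-invariant matrix difference operator on ℤ³ with coefficients
in ℚ̄[tanh β], whose symbol is invertible on the torus for β ∈ (β₀, β_c(3)) and singular somewhere
on the torus at β_c(3), forces tanh β_c(3) to be algebraic (det reduces to AlgebraicSpectralEdge;
tanh is a homeomorphism onto (−1,1)). [difficulty: L] -/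
@[route_item "route-CriticalPhenomena-DiracCensus"]
def DichotomyLemma : Prop :=
  ∀ (m : ℕ) (R : Finset (Fin 3 → ℤ)) (A : (Fin 3 → ℤ) → Matrix (Fin m) (Fin m) (Polynomial ℂ)) (β₀ : ℝ), (∀ u i j n, IsAlgebraic ℚ ((A u i j).coeff n)) → β₀ < Literature.Probability.LatticeModels.criticalBeta 3 → (∀ β ∈ Set.Ioo β₀ (Literature.Probability.LatticeModels.criticalBeta 3), ∀ θ : Fin 3 → ℝ, (∑ u ∈ R, Complex.exp (Complex.I * ∑ j : Fin 3, ((u j : ℤ) : ℂ) * ((θ j : ℝ) : ℂ)) • (A u).map (fun p => p.eval ((Real.tanh β : ℝ) : ℂ))).det ≠ 0) → (∃ θ : Fin 3 → ℝ, (∑ u ∈ R, Complex.exp (Complex.I * ∑ j : Fin 3, ((u j : ℤ) : ℂ) * ((θ j : ℝ) : ℂ)) • (A u).map (fun p => p.eval ((Real.tanh (Literature.Probability.LatticeModels.criticalBeta 3) : ℝ) : ℂ))).det = 0) → IsAlgebraic ℚ (Real.tanh (Literature.Probability.LatticeModels.criticalBeta 3))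

/-- item stmt-CriticalPhenomena-14440 · support · rank 10 · open · by planner
sources: Summits/CriticalPhenomena/Ising3DConformalLimit/Ideas/dirac-census-algebraic-betac.md, IkhlefCardy2009, BasuPollackRoy2006 Thm 2.77 and Cor 2.79
[support] GLUE (route-choice repair 2026-08-16, part 2): the route's DICHOTOMY as a checked edge —
the typed spine SpinorIdentityExists (r2, stmt-7158, typed 2026-08-15 by the crux-attack refuter
deliberately in DichotomyLemma's hypothesis shape: (Alg) algebraic coefficients, β₀ < β_c(3), (E)
symbol elliptic on 𝕋³ for β ∈ (β₀, β_c), (S) singular somewhere at β_c, plus the Ising link and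
non-degeneracy) together with the support DichotomyLemma gives the kill-switch crux
TanhCriticalBetaAlgebraic (r3). Pure logic: `intro hSI hDL; obtain ⟨m, k, R, A, P, β₀, hAlg, _, _,
hβ₀, _, hE, hS, _⟩ := hSI; exact hDL m R A β₀ hAlg hβ₀ hE hS` — checked in the planner's
Sketch2.lean against the verbatim ledger signature of stmt-7158 (rc 0, no sorry). Rank 10 (not 9)
only so that the gate renders the decl below DichotomyLemma (supports are ordered by rank, then item
id as a string). Why it is filed: with this edge a refutation of TanhCriticalBetaAlgebraic plus a
proof of DichotomyLemma refutes the spine mechanically (KILL CRITERIA (1)), and with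
CruxesGiveTarget the item graph now reads SpinorIdentityExists ∧ DichotomyLemma ⇒
TanhCriticalBetaAlgebraic; TanhCriticalBetaAlgebraic ∧ MoebiusLimitExists -/
@[route_item "route-CriticalPhenomena-DiracCensus"]
def SpineForcesAlgebraic : Prop :=
  SpinorIdentityExists → DichotomyLemma → TanhCriticalBetaAlgebraic

/-- item stmt-CriticalPhenomena-5413 · assembly · rank 1 · open · by planner
sources: ChelkakHonglerIzyurov2015, DuminilCopinICM2022
[assembly] MoebiusLimitExists → NonGaussianAnyLimit → Ising3DConformalLimit. -/
@[route_item "route-CriticalPhenomena-DiracCensus"]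
def Assembly : Prop :=
  MoebiusLimitExists → NonGaussianAnyLimit → Ising3DConformalLimit

/-! D-0027 §2.1 — DECIDING THEOREM (planner-authored via `route open/edit --closes-file`; by planner-rbadge-CriticalPhenomena-DiracCensus-ccd22261-g4-0 2026-08-15T16:13:42Z):
its hypotheses are this route's items and its conclusion the sub-problem Statement (glue_lint), and it elaborates with this file. -/

@[closes "route-CriticalPhenomena-DiracCensus"] theorem closes (hM : MoebiusLimitExists) (hN : NonGaussianAnyLimit) : _root_.Ising3DConformalLimit := by
  obtain ⟨ρ, Δ, S, hρ, hΔ, hlim, hnd, hmob⟩ := hM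
  exact ⟨ρ, Δ, S, hρ, hΔ, hlim, hnd, hmob, hN ρ S hρ hlim hnd⟩

end Summit.CriticalPhenomena.Ising3DConformalLimit.Theses.DiracCensus
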